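import Summits.CriticalPhenomena.PercolationContinuityZ3.Theorems.SahiMasterFamilyCommonPivotalReaders

/-!
# Glued frames at order three, II: a triple with a common pivotal coordinate and all faces structured is FULLY CORED

Unit `prim-masterthm-p4` (gen 12; crux anchor stmt-CriticalPhenomena-4575, helper work; memo
`run/shared/lean/prim/prim-masterthm/prim-masterthm-p4/P4-GEN12-REPORT.md`).  Continues `…CommonPivotalReaders`.

* `CPReaders.eq_orElse` — the third member is `orElse' e`; `CPReaders.singleton_mem_or` — a reader contains `{e}`;
* **`CPReaders.not_mem_esupp_gframe`** — the ORDER-THREE two-readers contradiction: in the (structured) contraction face at `e` the third member is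
  `orElse' e`, whose canonical frame is `orElse' e` or everything; the second option annihilates `∅` against a reader with trivial frame
  (T′ fails); the first forces both readers' frames, then both readers' face members, to be everything, i.e. `{e} ∈ U_a` and `{e} ∈ U_b`,
  and then the COMMON PIVOTAL coordinate `x ≠ e` acts on both deletion-face members `U_a^{e←0}`, `U_b^{e←0}`, which are pure with
  DISJOINT blocks — contradiction.  (Without the common pivotal coordinate this is exactly the blown-up triangle
  `(e ∨ OR(S_a), e ∨ OR(S_b), OR(S_a ∪ S_b))`, the known order-three exception.)
* `gframe_disjoint_of_commonPivotal` — hence the glued frames have pairwise disjoint supports;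
* **`not_coreFree_of_commonPivotal`** — and (prim-master-conj's `two_le_card_pure` + `faceFConsistent_of_noAbsorber`) there is NO
  core-free coordinate: two pure members would be independent, contradicting the common pivotal coordinate;
* **`eq_univ_of_mem_cap_of_commonPivotal`** — so the common part `⋂ U_j` is `{univ}` (principal cap): the no-absorber case of the
  tightness statement `FaceVanishingCommonPivotalTight` on the full coordinate set.
Pure combinatorics; axioms standard. [this work]
-/

noncomputable section

open scoped Classical

namespace Summit.CriticalPhenomena.PercolationContinuityZ3.Theorems

namespace PositiveSomewhere

open Finset Function GluedFrames
open Literature.Probability.LatticeModels.Kahn2022 (Affects)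

variable {ι : Type*} [Fintype ι] {κ : Type*} {U : κ → Set (Set ι)} {W : Finset κ}

namespace CPReaders

variable {e : ι} {a b : κ} (D : CPReaders U W e a b)
include D

/-- The third member. [this work] -/
theorem exists_third : ∃ m ∈ W, m ≠ a ∧ m ≠ b := by
  have hpos : 0 < ((W.erase a).erase b).card := by
    rw [card_erase_of_mem (mem_erase.2 ⟨D.hab.symm, D.hWU b⟩), card_erase_of_mem (D.hWU a), D.hcard]; norm_num
  obtain ⟨m, hm⟩ := card_pos.1 hpos
  exact ⟨m, mem_of_mem_erase (mem_of_mem_erase hm), ne_of_mem_erase (mem_of_mem_erase hm), ne_of_mem_erase hm⟩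

/-- There are only three members: anything other than the third member is a reader. [this work] -/
theorem eq_or_eq_of_ne {m l : κ} (hma : m ≠ a) (hmb : m ≠ b) (hlm : l ≠ m) : l = a ∨ l = b := by
  by_contra h
  rw [not_or] at h
  have hsub : ({l, a, b, m} : Finset κ) ⊆ W := by
    intro z hz
    simp only [mem_insert, mem_singleton] at hz
    rcases hz with rfl | rfl | rfl | rfl <;> exact D.hWU _
  have h4 : ({l, a, b, m} : Finset κ).card = 4 := by
    rw [card_insert_of_notMem (by simp [h.1, h.2, hlm]), card_insert_of_notMem (by simp [D.hab, hma.symm]),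
      card_pair (fun h' => hmb h'.symm)]
  have := card_le_card hsub
  rw [h4, D.hcard] at this
  omega

/-- **The third member is `orElse' e`**: every configuration with a coordinate other than `e` lies in it, `{e}` does not. [this work] -/
theorem eq_orElse {m : κ} (hma : m ≠ a) (hmb : m ≠ b) : U m = orElse' e := by
  have hU := D.hU
  -- T′ in the deletion face: a configuration outside `(U m)^{e←0}` misses both blocks, hence is inside `{e}`
  have hsub : orElse' e ⊆ U m := by
    rintro ψ ⟨y, hy, hye⟩
    by_contra hψ
    have hψ' : ψ \ {e} ∉ faceF U e m := by
      rw [faceF_apply, mem_secAt_false_iff_of_notMem (fun h => h.2 rfl : e ∉ ψ \ {e})]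
      exact fun h => hψ (hU m Set.sdiff_subset h)
    have hA : ψ \ {e} ∈ cframe (faceF U e) W m := by rw [D.cframe_faceF_eq_univ hma hmb]; exact Set.mem_univ _
    have h2 := two_le_card_cfail_of_annihilator (faceF U e) D.hΦU D.hΦne D.hF (D.hWU m) hA hψ'
    have hsubset : ((W.erase m).filter fun w => ψ \ {e} ∉ cframe (faceF U e) W w) ⊆ {a, b} := by
      intro c hc
      rw [mem_filter, mem_erase] at hc
      simp only [mem_insert, mem_singleton]
      exact D.eq_or_eq_of_ne hma hmb hc.1.1
    have hcard2 : (({a, b} : Finset κ)).card = 2 := card_pair D.hab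
    have heq : ((W.erase m).filter fun w => ψ \ {e} ∉ cframe (faceF U e) W w) = {a, b} :=
      eq_of_subset_of_card_le hsubset (by rw [hcard2]; exact h2)
    have haf : a ∈ ((W.erase m).filter fun w => ψ \ {e} ∉ cframe (faceF U e) W w) := by rw [heq]; simp
    rw [mem_filter] at haf
    apply haf.2
    rw [D.mem_cframe_faceF_a_iff]
    rcases D.mem_esupp_or hye with hya | hyb
    · exact ⟨y, ⟨hy, hye⟩, hya⟩
    · exfalso
      have hbf : b ∈ ((W.erase m).filter fun w => ψ \ {e} ∉ cframe (faceF U e) W w) := by rw [heq]; simp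
      rw [mem_filter] at hbf
      exact hbf.2 ((D.symm.mem_cframe_faceF_a_iff _).2 ⟨y, ⟨hy, hye⟩, hyb⟩)
  refine Set.Subset.antisymm (fun ω hω => ?_) hsub
  by_contra hωR
  have hωe : ω ⊆ {e} := not_mem_orElse'_iff.1 hωR
  -- then `U m` contains every non-empty configuration and absorbs every other member
  have hall : ∀ ω' : Set ι, ω'.Nonempty → ω' ∈ U m := by
    intro ω' ⟨z, hz⟩
    by_cases hz' : z = e
    · subst hz'
      by_cases hR : ω' ∈ orElse' z
      · exact hsub hR
      · have : ω' = ω := by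
          have h1 := not_mem_orElse'_iff.1 hR
          have hωz : z ∈ ω := by
            rcases Set.eq_empty_or_nonempty ω with rfl | ⟨w, hw⟩
            · exact absurd (Set.eq_univ_of_forall fun x => hU m (Set.empty_subset x) hω) (D.hns m)
            · have := hωe hw; rw [Set.mem_singleton_iff] at this; exact this ▸ hw
          exact Set.Subset.antisymm (fun x hx => by have := h1 hx; rw [Set.mem_singleton_iff] at this; exact this ▸ hωz)
            (fun x hx => by have := hωe hx; rw [Set.mem_singleton_iff] at this; exact this ▸ hz)
        rw [this]; exact hω
    · exact hsub ⟨z, hz, hz'⟩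
  obtain ⟨l, -, -, hnot⟩ := D.habs m (D.hWU m)
  exact hnot fun ω' hω' => hall ω' (Set.nonempty_iff_ne_empty.2 fun h =>
    D.hns l (Set.eq_univ_of_forall fun x => hU l (Set.empty_subset x) (h ▸ hω')))

/-- Some reader contains `{e}` (no member contains the other two). [this work] -/
theorem singleton_mem_or : ({e} : Set ι) ∈ U a ∨ ({e} : Set ι) ∈ U b := by
  obtain ⟨m, hm, hma, hmb⟩ := D.exists_third
  obtain ⟨l, -, hlm, hnot⟩ := D.habs m hm
  have hUm := D.eq_orElse hma hmb
  have key : ∀ {l}, ¬ U l ⊆ U m → ({e} : Set ι) ∈ U l := by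
    intro l hnot'
    by_contra hel
    refine hnot' fun ω hω => ?_
    rw [hUm]
    by_contra hR
    have hωe := not_mem_orElse'_iff.1 hR
    rcases Set.eq_empty_or_nonempty ω with rfl | ⟨z, hz⟩
    · exact D.hns l (Set.eq_univ_of_forall fun x => D.hU l (Set.empty_subset x) hω)
    · have hze : z = e := by have := hωe hz; rwa [Set.mem_singleton_iff] at this
      have : ω = {e} := Set.Subset.antisymm hωe (by rw [← hze]; exact Set.singleton_subset_iff.2 hz)
      exact hel (this ▸ hω)
  rcases D.eq_or_eq_of_ne hma hmb hlm with rfl | rfl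
  · exact Or.inl (key hnot)
  · exact Or.inr (key hnot)

/-- **The common pivotal coordinate forbids `{e}` in both readers**: it is not `e` (it acts on the third member `orElse' e`), so it acts
on both deletion-face members, which are pure with disjoint blocks. [this work] -/
theorem false_of_singleton_mem_both (hea : ({e} : Set ι) ∈ U a) (heb : ({e} : Set ι) ∈ U b) : False := by
  obtain ⟨x, hx⟩ := D.hx
  obtain ⟨m, -, hma, hmb⟩ := D.exists_third
  have hUm := D.eq_orElse hma hmb
  have hxe : x ≠ e := by
    intro h; subst h
    exact not_mem_esupp_orElse'_self x (by rw [← hUm]; exact mem_esupp.2 (hx m))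
  -- `x` acts on the deletion-face member of a reader containing `{e}`
  have key : ∀ {c}, ({e} : Set ι) ∈ U c → x ∈ esupp (faceF U e c) := by
    intro c hec
    obtain ⟨ω, hω, hωx⟩ := hx c
    have heω : e ∉ ω := fun h => hω (D.hU c (Set.singleton_subset_iff.2 h) hec)
    have heω' : e ∉ insert x ω := by
      rintro (h | h)
      · exact hxe h.symm
      · exact heω h
    refine mem_esupp.2 ⟨ω, ?_, ?_⟩
    · rw [faceF_apply, mem_secAt_false_iff_of_notMem heω]; exact hω
    · rw [faceF_apply, mem_secAt_false_iff_of_notMem heω']; exact hωx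
  have hxa : x ∈ esupp (cframe (faceF U e) W a) := by rw [D.cframe_faceF_a]; exact key hea
  have hxb : x ∈ esupp (cframe (faceF U e) W b) := by rw [D.symm.cframe_faceF_a]; exact key heb
  exact Finset.disjoint_left.1 (disjoint_esupp_cframe _ D.hΦU D.hΦne D.hF (D.hWU a) (D.hWU b) D.hab) hxa hxb

/-- **The contraction face at `e` cannot be structured when `{e} ∈ U a`** (order three, common pivotal coordinate). [this work] -/
theorem false_of_singleton_mem (hea : ({e} : Set ι) ∈ U a) : False := by
  have hU := D.hU
  set V := faceT U e with hVdef
  have hVU : ∀ k, IsUpperSet (V k) := isUpperSet_faceT U hU e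
  have hVne : ∀ k, (V k).Nonempty := faceT_nonempty U hU D.hne e
  have hVS : Structured V W := D.hS e
  obtain ⟨m, hm, hma, hmb⟩ := D.exists_third
  have hVm : V m = orElse' e := by rw [hVdef, faceT_apply, D.eq_orElse hma hmb, secAt_true_orElse']
  have hVa : V a = Set.univ := by
    refine Set.eq_univ_of_forall fun ω => ?_
    rw [hVdef, faceT_apply, mem_secAt]; simp only [forceAt, cond_true]
    exact hU a (Set.singleton_subset_iff.2 (Set.mem_insert e ω)) hea
  have hfr : ∀ {j}, j ∈ W → secAt e true (cframe V W j) = cframe V W j :=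
    fun {j} hj => cframe_faceT_ignores U W hU D.hne hVS hj
  have hFa : cframe V W a = Set.univ :=
    Set.eq_univ_of_forall fun ω => subset_cframe V hVU W a (by rw [hVa]; exact Set.mem_univ ω)
  have hRU : cframe V W m = orElse' e ∨ cframe V W m = Set.univ :=
    eq_orElse'_or_univ (isUpperSet_cframe V hVU W m) (hfr hm) (by rw [← hVm]; exact subset_cframe V hVU W m)
  rcases hRU with hFm | hFm
  · -- the frame of `b` avoids the support of `orElse' e` and `e`: it is everything
    have hbm : b ≠ m := fun h => hmb h.symm
    have hbe : esupp (cframe V W b) = ∅ := by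
      refine eq_empty_of_forall_notMem fun z hz => ?_
      by_cases hze : z = e
      · subst hze
        have := not_affects_secAt z true (cframe V W b)
        rw [hfr (D.hWU b)] at this
        exact this (mem_esupp.1 hz)
      · have hd := disjoint_esupp_cframe V hVU hVne hVS (D.hWU b) hm hbm
        rw [hFm] at hd
        exact Finset.disjoint_left.1 hd hz (mem_esupp_orElse' hze)
    have hFb : cframe V W b = Set.univ :=
      eq_univ_of_esupp_eq_empty' (isUpperSet_cframe V hVU W b)
        ⟨_, subset_cframe V hVU W b (univ_mem_of_nonempty (hVU b) (hVne b))⟩ hbe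
    -- `V b` is everything too: an annihilator point of `b` would have to fail two of {a, m}, but `a`'s frame is everything
    have hVb : V b = Set.univ := by
      by_contra hne'
      obtain ⟨ω, hω⟩ : ∃ ω, ω ∉ V b := by
        by_contra h; push Not at h
        exact hne' (Set.eq_univ_of_forall h)
      have h2 := two_le_card_cfail_of_annihilator V hVU hVne hVS (D.hWU b) (by rw [hFb]; exact Set.mem_univ ω) hω
      have hsub : ((W.erase b).filter fun w => ω ∉ cframe V W w) ⊆ {m} := by
        intro c hc
        rw [mem_filter, mem_erase] at hc
        rw [mem_singleton]
        by_contra hcm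
        rcases D.eq_or_eq_of_ne hma hmb hcm with rfl | rfl
        · exact hc.2 (by rw [hFa]; exact Set.mem_univ _)
        · exact hc.1.1 rfl
      have := card_le_card hsub
      rw [card_singleton] at this
      omega
    have heb : ({e} : Set ι) ∈ U b := by
      have h0 : (∅ : Set ι) ∈ V b := by rw [hVb]; exact Set.mem_univ _
      rw [hVdef, faceT_apply, mem_secAt] at h0
      simp only [forceAt, cond_true] at h0
      rwa [show insert e (∅ : Set ι) = {e} from by ext; simp] at h0
    exact D.false_of_singleton_mem_both hea heb
  · -- `∅` is annihilated by `m`; T′ needs two members other than `m` failing `∅`, but `a`'s frame is everything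
    have h0A : (∅ : Set ι) ∈ cframe V W m := by rw [hFm]; exact Set.mem_univ _
    have h0U : (∅ : Set ι) ∉ V m := by rw [hVm]; rintro ⟨z, hz, -⟩; exact hz
    have h2 := two_le_card_cfail_of_annihilator V hVU hVne hVS hm h0A h0U
    have hsub : ((W.erase m).filter fun w => (∅ : Set ι) ∉ cframe V W w) ⊆ {b} := by
      intro c hc
      rw [mem_filter, mem_erase] at hc
      rw [mem_singleton]
      rcases D.eq_or_eq_of_ne hma hmb hc.1.1 with rfl | rfl
      · exact absurd (by rw [hFa]; exact Set.mem_univ _) hc.2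
      · rfl
    have := card_le_card hsub
    rw [card_singleton] at this
    omega

/-- **A core-free coordinate lies in at most one glued block (order three, common pivotal coordinate)**: the standing data are
contradictory — stated as "`e` is not read by the glued frame of `b`" (which contradicts `D.hb`). [this work] -/
theorem not_mem_esupp_gframe : e ∉ esupp (gframe U W b) := fun _ => by
  rcases D.singleton_mem_or with h | h
  · exact D.false_of_singleton_mem h
  · exact D.symm.false_of_singleton_mem h

end CPReaders

/-! ### Consequences: disjoint glued frames, no core-free coordinate, principal cap -/

variable (U W)

/-- **The glued frames of a triple with a common pivotal coordinate have pairwise disjoint supports** (three non-empty non-sure increasing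
events, structured contraction faces, structured deletion faces at core-free coordinates, no member containing the other two). [this work] -/
theorem gframe_disjoint_of_commonPivotal (hU : ∀ k, IsUpperSet (U k)) (hne : ∀ k, (U k).Nonempty) (hns : ∀ k, U k ≠ Set.univ)
    (hWU : ∀ k, k ∈ W) (hcard : W.card = 3) (hS : ∀ h, Structured (faceT U h) W)
    (habs : ∀ l ∈ W, ∃ m ∈ W, m ≠ l ∧ ¬ U m ⊆ U l) (hx : ∃ x : ι, ∀ k, Affects (U k) x)
    (hF : ∀ f, CoreFree U f → Structured (faceF U f) W) :
    ∀ w ∈ W, ∀ w' ∈ W, w ≠ w' → Disjoint (esupp (gframe U W w)) (esupp (gframe U W w')) := by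
  intro w _ w' _ hww'
  rw [Finset.disjoint_left]
  intro y hy hy'
  by_cases hcf : CoreFree U y
  · exact (CPReaders.mk hU hne hns hWU hcard hS habs hx hcf (hF y hcf) hww' hy hy' : CPReaders U W y w w').not_mem_esupp_gframe hy'
  · unfold CoreFree at hcf
    push Not at hcf
    obtain ⟨l, hl⟩ := hcf
    have hcore : ∀ ω ∈ U l, y ∈ ω := by
      intro ω hω
      by_contra hyω
      exact hl (hU l (fun z hz => ⟨Set.mem_univ z, fun h => hyω (by rw [Set.mem_singleton_iff] at h; exact h ▸ hz)⟩) hω)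
    by_cases hwl : w = l
    · subst hwl
      exact not_mem_esupp_gframe_of_core' U W hU hne hS (hWU w) (hWU w') (fun h => hww' h.symm) hcore hy'
    · exact not_mem_esupp_gframe_of_core' U W hU hne hS (hWU l) (hWU w) hwl hcore hy

/-- **No core-free coordinate**: under the same hypotheses every coordinate lies in the core of some member (else prim-master-conj's
`two_le_card_pure` yields two pure members with disjoint supports, i.e. an independent pair, contradicting the common pivotal
coordinate). [this work] -/
theorem not_coreFree_of_commonPivotal (hU : ∀ k, IsUpperSet (U k)) (hne : ∀ k, (U k).Nonempty) (hns : ∀ k, U k ≠ Set.univ)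
    (hWU : ∀ k, k ∈ W) (hcard : W.card = 3) (hS : ∀ h, Structured (faceT U h) W)
    (habs : ∀ l ∈ W, ∃ m ∈ W, m ≠ l ∧ ¬ U m ⊆ U l) (hx : ∃ x : ι, ∀ k, Affects (U k) x)
    (hF : ∀ f, CoreFree U f → Structured (faceF U f) W) (f : ι) : ¬ CoreFree U f := by
  intro hf
  have hd := gframe_disjoint_of_commonPivotal U W hU hne hns hWU hcard hS habs hx hF
  have h3 : 3 ≤ W.card := hcard ▸ le_rfl
  have h2 : 2 ≤ W.card := by omega
  have hFc : ∀ f, CoreFree U f → Structured (faceF U f) W ∧ FaceFConsistent U W f :=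
    fun f hf => ⟨hF f hf, faceFConsistent_of_noAbsorber U W hU hne hns hS hd habs h3 hf (hF f hf)⟩
  obtain ⟨k₀, hk₀⟩ : ∃ k, k ∈ W := card_pos.1 (by omega)
  have hι : ∀ f' : ι, ∃ h, h ≠ f' := by
    intro f'
    by_contra h
    push Not at h
    have hempty : (Set.univ : Set ι) \ {f} = ∅ := by
      ext z
      simp only [Set.mem_sdiff, Set.mem_univ, Set.mem_singleton_iff, true_and, Set.mem_empty_iff_false, iff_false, not_not]
      rw [h z, h f]
    exact hns k₀ (Set.eq_univ_of_forall fun ω => hU k₀ (Set.empty_subset ω) (hempty ▸ hf k₀))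
  have hpure := two_le_card_pure U W hU hne hWU hS hd hFc ⟨f, hf⟩ h2 hι
  obtain ⟨p, hp, q, hq, hpq⟩ := one_lt_card.1 (by omega : 1 < (W.filter fun w => gann U W w = ∅).card)
  rw [mem_filter] at hp hq
  have hgp : gframe U W p = U p := (gann_eq_empty_iff U W hU p).1 hp.2
  have hgq : gframe U W q = U q := (gann_eq_empty_iff U W hU q).1 hq.2
  obtain ⟨x, hx⟩ := hx
  have := hd p hp.1 q hq.1 hpq
  rw [hgp, hgq] at this
  exact Finset.disjoint_left.1 this (mem_esupp.2 (hx p)) (mem_esupp.2 (hx q))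

/-- **Principal cap (fully cored)**: under the same hypotheses the only configuration in every member is `univ`. [this work] -/
theorem eq_univ_of_mem_cap_of_commonPivotal (hU : ∀ k, IsUpperSet (U k)) (hne : ∀ k, (U k).Nonempty) (hns : ∀ k, U k ≠ Set.univ)
    (hWU : ∀ k, k ∈ W) (hcard : W.card = 3) (hS : ∀ h, Structured (faceT U h) W)
    (habs : ∀ l ∈ W, ∃ m ∈ W, m ≠ l ∧ ¬ U m ⊆ U l) (hx : ∃ x : ι, ∀ k, Affects (U k) x)
    (hF : ∀ f, CoreFree U f → Structured (faceF U f) W) {T : Set ι} (hT : ∀ k, T ∈ U k) : T = Set.univ := by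
  by_contra hT'
  obtain ⟨f, hf⟩ : ∃ f, f ∉ T := by
    by_contra h
    push Not at h
    exact hT' (Set.eq_univ_of_forall h)
  refine not_coreFree_of_commonPivotal U W hU hne hns hWU hcard hS habs hx hF f fun k => hU k (fun z hz => ?_) (hT k)
  exact ⟨Set.mem_univ z, fun h => hf (by rw [Set.mem_singleton_iff] at h; exact h ▸ hz)⟩

end PositiveSomewhere

end Summit.CriticalPhenomena.PercolationContinuityZ3.Theorems
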